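import Summits.QuantumFields.QCD.Theorems.WilsonMobilityGapMobilityGapSketchWindow

/-!
# Crux `MobilityGap` (stmt-QuantumFields-9150) — line `Sketch`: the window law is WEAKER than the extinction law (`N_f = 2`)

Helper file `--supports stmt-QuantumFields-9150`, registered sub-goal `windowLaw_of_extinctLaw_two` of the line
`Sketch` (skeleton v5 ≤ skeleton v4 on the sign side).

Skeleton v4 feeds clause (iv) of the crux at `N_f = 2` from the EXTINCTION law `ExtinctAt d`
(`…SketchFreeDefs.lean` §5): the phase-quenched expected number `Σ_f #{real eigenvalues of D_W(U,0,1) below −t_f}`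
is `≤ 1/4` at the scheme's volume.  Skeleton v5 (`…SketchWindow.lean`) replaces it, for two flavours, by the WINDOW
law: the phase-quenched expected number of real eigenvalues in the open spread window `(−max(t₀,t₁), −min(t₀,t₁))`
is `≤ 1/4`.  This file checks that the replacement is a weakening: configurationwise, a real eigenvalue in the
spread window lies below `−min(t₀,t₁) = −t_{f₀}` for the flavour `f₀` achieving the minimum, so it is one of the
deep crossers of flavour `f₀` (§1); integrating against the common non-negative weight `∏_f |det D_W(U,t_f,1)|`
and dividing by the common normalisation gives `E₊[#window] ≤ E₊[Σ_f #deep crossers]` torus by torus (§2); the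
quantifier shell of the two laws is identical (§3).

§1 the pointwise multiset inequality · §2 the integrated inequality at fixed torus side, coupling and bare pair ·
§3 the registered implication `(∀ d, LightMomentAt → ExtinctAt d) → (∀ d, LightMomentAt → window law along d)`.
-/

noncomputable section

namespace Summit.QuantumFields.QCD.Theorems.MobilityGapSketch

open scoped BigOperators Topology
open MeasureTheory Filter Set
open Literature.MathematicalPhysics.QuantumFieldTheory Literature.MathematicalPhysics.QuantumLattice
  Literature.Probability.LatticeModels

/-! ### §1 Pointwise: a window root is a deep crosser of the lighter flavour -/

/-- **Window count ≤ two-flavour deep-crosser count** (multisets).  For every multiset `s` of complex numbers and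
every pair `t : Fin 2 → ℝ`, the number of real elements in the open spread window `(−max(t₀,t₁), −min(t₀,t₁))` is
at most `Σ_{f : Fin 2} #{z ∈ s : Im z = 0, Re z < −t_f}`: a window element has `Re z < −min(t₀,t₁) = −t_{f₀}` for the
index `f₀` achieving the minimum, and the other summand is non-negative. [folklore] -/
theorem countP_window_le_sum_countP_real_lt (s : Multiset ℂ) (t : Fin 2 → ℝ) :
    s.countP (fun z : ℂ => z.im = 0 ∧ -max (t 0) (t 1) < z.re ∧ z.re < -min (t 0) (t 1)) ≤
      ∑ f : Fin 2, s.countP (fun z : ℂ => z.im = 0 ∧ z.re < -t f) := by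
  classical
  have hmono : ∀ f : Fin 2, min (t 0) (t 1) = t f →
      s.countP (fun z : ℂ => z.im = 0 ∧ -max (t 0) (t 1) < z.re ∧ z.re < -min (t 0) (t 1)) ≤
        s.countP (fun z : ℂ => z.im = 0 ∧ z.re < -t f) := by
    intro f hf
    rw [Multiset.countP_eq_card_filter, Multiset.countP_eq_card_filter]
    refine Multiset.card_le_card (Multiset.monotone_filter_right _ fun z hz => ⟨hz.1, ?_⟩)
    rw [← hf]
    exact hz.2.2
  rw [Fin.sum_univ_two]
  rcases min_choice (t 0) (t 1) with h | h
  · exact (hmono 0 h).trans (Nat.le_add_right _ _)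
  · exact (hmono 1 h).trans (Nat.le_add_left _ _)

/-! ### §2 The integrated inequality on a fixed torus -/

variable {N : ℕ} [NeZero N]

/-- **Expected window count ≤ expected two-flavour deep-crosser count.**  For every torus side, coupling `β` and
bare pair `t`, the phase-quenched expectation (quotient of Wilson-measure integrals with the weight
`∏_f |det D_W(U,t_f,1)|`) of the number of real eigenvalues of `D_W(U,0,1)` in the spread window
`(−max(t₀,t₁), −min(t₀,t₁))` is at most that of `Σ_f #{real eigenvalues of D_W(U,0,1) below −t_f}`.
(Integrate §1 against the non-negative weight — both counts are measurable (`measurable_countP_charpoly_roots_window`,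
`measurable_countP_charpoly_roots_real_lt`) and bounded by `2·12N⁴`, the weight is integrable — and divide by the
common non-negative normalisation.) -/
theorem windowQuotient_le_extinctQuotient_two (β : ℝ) (t : Fin 2 → ℝ) :
    (∫ U : GaugeConfig 4 N (Matrix.specialUnitaryGroup (Fin 3) ℂ),
        ((wilsonDirac (fundamentalRep (Fin 3)) U 0 1).charpoly.roots.countP
            (fun z : ℂ => z.im = 0 ∧ -max (t 0) (t 1) < z.re ∧ z.re < -min (t 0) (t 1)) : ℝ) *
          ∏ f : Fin 2, ‖fermionDet (wilsonDirac (fundamentalRep (Fin 3)) U (t f) 1)‖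
        ∂(wilsonMeasure (d := 4) (L := N) (fundamentalRep (Fin 3)) β)) /
      (∫ U : GaugeConfig 4 N (Matrix.specialUnitaryGroup (Fin 3) ℂ),
        ∏ f : Fin 2, ‖fermionDet (wilsonDirac (fundamentalRep (Fin 3)) U (t f) 1)‖
        ∂(wilsonMeasure (d := 4) (L := N) (fundamentalRep (Fin 3)) β)) ≤
    (∫ U : GaugeConfig 4 N (Matrix.specialUnitaryGroup (Fin 3) ℂ),
        (∑ f : Fin 2, (Multiset.countP (fun z : ℂ => z.im = 0 ∧ z.re < -t f)
          (wilsonDirac (fundamentalRep (Fin 3)) U 0 1).charpoly.roots : ℝ)) *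
          ∏ f : Fin 2, ‖fermionDet (wilsonDirac (fundamentalRep (Fin 3)) U (t f) 1)‖
        ∂(wilsonMeasure (d := 4) (L := N) (fundamentalRep (Fin 3)) β)) /
      (∫ U : GaugeConfig 4 N (Matrix.specialUnitaryGroup (Fin 3) ℂ),
        ∏ f : Fin 2, ‖fermionDet (wilsonDirac (fundamentalRep (Fin 3)) U (t f) 1)‖
        ∂(wilsonMeasure (d := 4) (L := N) (fundamentalRep (Fin 3)) β)) := by
  classical
  set μ := wilsonMeasure (d := 4) (L := N) (fundamentalRep (Fin 3)) β with hμ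
  set A : GaugeConfig 4 N (Matrix.specialUnitaryGroup (Fin 3) ℂ) → ℝ := fun U =>
    ∏ f : Fin 2, ‖fermionDet (wilsonDirac (fundamentalRep (Fin 3)) U (t f) 1)‖ with hA
  set W : GaugeConfig 4 N (Matrix.specialUnitaryGroup (Fin 3) ℂ) → ℝ := fun U =>
    (((wilsonDirac (fundamentalRep (Fin 3)) U 0 1).charpoly.roots.countP
      (fun z : ℂ => z.im = 0 ∧ -max (t 0) (t 1) < z.re ∧ z.re < -min (t 0) (t 1)) : ℝ)) with hW
  set E : GaugeConfig 4 N (Matrix.specialUnitaryGroup (Fin 3) ℂ) → ℝ := fun U =>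
    ∑ f : Fin 2, ((wilsonDirac (fundamentalRep (Fin 3)) U 0 1).charpoly.roots.countP
      (fun z : ℂ => z.im = 0 ∧ z.re < -t f) : ℝ) with hE
  change (∫ U, W U * A U ∂μ) / (∫ U, A U ∂μ) ≤ (∫ U, E U * A U ∂μ) / (∫ U, A U ∂μ)
  have hAeq : A = fun U => ‖(diracMatrix U t).det‖ := funext fun U => (norm_det_diracMatrix U t).symm
  -- the weight: non-negative and integrable
  have hAi : Integrable A μ := by rw [hAeq]; exact integrable_norm_det_diracMatrix t μ
  have hA0 : ∀ U, 0 ≤ A U := fun U => Finset.prod_nonneg fun f _ => norm_nonneg _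
  have hZ0 : 0 ≤ ∫ U, A U ∂μ := integral_nonneg hA0
  -- the two counts: measurable, non-negative, ordered, bounded
  have hWm : Measurable W :=
    (measurable_from_nat (f := (Nat.cast : ℕ → ℝ))).comp
      (measurable_countP_charpoly_roots_window
        (continuous_wilsonDirac (fundamentalRep (Fin 3)) (continuous_fundamentalRep (Fin 3)) 0 1) _ _)
  have hEm : Measurable E := by
    refine Finset.measurable_sum _ fun f _ => ?_
    exact (measurable_from_nat (f := (Nat.cast : ℕ → ℝ))).comp
      (PositivityDeficitLeDefects.measurable_countP_charpoly_roots_real_lt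
        (continuous_wilsonDirac (fundamentalRep (Fin 3)) (continuous_fundamentalRep (Fin 3)) 0 1) (-t f))
  have hW0 : ∀ U, 0 ≤ W U := fun U => Nat.cast_nonneg _
  have hE0 : ∀ U, 0 ≤ E U := fun U => Finset.sum_nonneg fun f _ => Nat.cast_nonneg _
  have hWE : ∀ U, W U ≤ E U := fun U => by
    simp only [hW, hE]
    exact_mod_cast countP_window_le_sum_countP_real_lt
      (wilsonDirac (fundamentalRep (Fin 3)) U 0 1).charpoly.roots t
  have hle : ∀ (U : GaugeConfig 4 N (Matrix.specialUnitaryGroup (Fin 3) ℂ)) (f : Fin 2),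
      ((wilsonDirac (fundamentalRep (Fin 3)) U 0 1).charpoly.roots.countP
        (fun z : ℂ => z.im = 0 ∧ z.re < -t f) : ℝ) ≤ Fintype.card (TorusSite 4 N × Fin 3 × Fin 4) := by
    intro U f
    have h1 := Multiset.countP_le_card (fun z : ℂ => z.im = 0 ∧ z.re < -t f)
      (wilsonDirac (fundamentalRep (Fin 3)) U 0 1).charpoly.roots
    have h2 := Polynomial.card_roots' (wilsonDirac (fundamentalRep (Fin 3)) U 0 1).charpoly
    rw [Matrix.charpoly_natDegree_eq_dim] at h2
    exact_mod_cast h1.trans h2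
  have hEle : ∀ U, E U ≤ 2 * Fintype.card (TorusSite 4 N × Fin 3 × Fin 4) := by
    intro U
    simp only [hE, Fin.sum_univ_two, two_mul]
    exact add_le_add (hle U 0) (hle U 1)
  -- integrability of the two integrands
  have hEAi : Integrable (fun U => E U * A U) μ := by
    refine (hAi.const_mul (2 * Fintype.card (TorusSite 4 N × Fin 3 × Fin 4))).mono'
      (hEm.aestronglyMeasurable.mul hAi.aestronglyMeasurable) (Eventually.of_forall fun U => ?_)
    rw [Real.norm_eq_abs, abs_of_nonneg (mul_nonneg (hE0 U) (hA0 U))]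
    exact mul_le_mul_of_nonneg_right (hEle U) (hA0 U)
  have hWAi : Integrable (fun U => W U * A U) μ := by
    refine hEAi.mono' (hWm.aestronglyMeasurable.mul hAi.aestronglyMeasurable)
      (Eventually.of_forall fun U => ?_)
    rw [Real.norm_eq_abs, abs_of_nonneg (mul_nonneg (hW0 U) (hA0 U))]
    exact mul_le_mul_of_nonneg_right (hWE U) (hA0 U)
  -- integrate the pointwise bound and divide by the common normalisation
  have hint : ∫ U, W U * A U ∂μ ≤ ∫ U, E U * A U ∂μ :=
    integral_mono hWAi hEAi fun U => mul_le_mul_of_nonneg_right (hWE U) (hA0 U)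
  exact div_le_div_of_nonneg_right hint hZ0

/-! ### §3 The registered implication: skeleton v5 is a weakening of skeleton v4 on the sign side -/

/-- **The window law follows from the extinction law (`N_f = 2`)** — registered sub-goal
`windowLaw_of_extinctLaw_two` of line `Sketch` of the crux `MobilityGap`: if every admissible two-flavour datum
carrying a light moment satisfies the deep-crosser extinction law `ExtinctAt d`, then every such datum satisfies
the WINDOW law (same admissible volume sequence `L ≥ L⁰`, same `δ`/`M`/`k`/`t` shell; the expected window count is
dominated by the expected deep-crosser count, `windowQuotient_le_extinctQuotient_two`). -/
theorem windowLaw_of_extinctLaw_two : (∀ d : LineData 2, LightMomentAt 2 d.a d.β d.s → ExtinctAt d) →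
    ∀ d : LineData 2, LightMomentAt 2 d.a d.β d.s → ∃ L : ℕ → ℕ, Tendsto (fun k => d.a k * (L k : ℝ)) atTop atTop ∧
    (∀ᶠ k in atTop, d.vfloor k ≤ L k) ∧ ∀ᶠ δ in atTop, ∀ M : ℝ, 0 < M → ∀ᶠ k in atTop,
    (floorSetD d δ k).Nonempty → -1 < thrD d δ k → ∀ t : Fin 2 → ℝ, (∀ f, thrD d δ k < t f) →
    (∀ f, t f ≤ thrD d δ k + d.a k * M / d.zm k) →
    (∫ U : GaugeConfig 4 (2 * L k + 1) (Matrix.specialUnitaryGroup (Fin 3) ℂ),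
    ((wilsonDirac (fundamentalRep (Fin 3)) U 0 1).charpoly.roots.countP
    (fun z : ℂ => z.im = 0 ∧ -max (t 0) (t 1) < z.re ∧ z.re < -min (t 0) (t 1)) : ℝ) *
    ∏ f : Fin 2, ‖fermionDet (wilsonDirac (fundamentalRep (Fin 3)) U (t f) 1)‖
    ∂(wilsonMeasure (d := 4) (L := 2 * L k + 1) (fundamentalRep (Fin 3)) (d.β k))) /
    (∫ U : GaugeConfig 4 (2 * L k + 1) (Matrix.specialUnitaryGroup (Fin 3) ℂ),
    ∏ f : Fin 2, ‖fermionDet (wilsonDirac (fundamentalRep (Fin 3)) U (t f) 1)‖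
    ∂(wilsonMeasure (d := 4) (L := 2 * L k + 1) (fundamentalRep (Fin 3)) (d.β k))) ≤ 1 / 4 := by
  intro hExt d hd
  obtain ⟨L, hL, hfl, hδ⟩ := hExt d hd
  refine ⟨L, hL, hfl, hδ.mono fun δ hδ' M hM => (hδ' M hM).mono fun k hk hne hthr t ht₁ ht₂ => ?_⟩
  exact (windowQuotient_le_extinctQuotient_two (d.β k) t).trans (hk hne hthr t ht₁ ht₂)

end Summit.QuantumFields.QCD.Theorems.MobilityGapSketch

end
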